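import Literature.NumberTheory.GelbartRogawski1991.Sec1Defs
import Literature.NumberTheory.Automorphic.UnitaryGroupBorelInduction
import HarnessLib

/-!
# Gelbart–Rogawski 1991, §1 «Preliminaries» (pp. 449–451) with the Introduction's packet sentences (p. 446):
# §1.1 the form `Φ`, `[w,t]`, `d(α,β,ᾱ⁻¹)`; §1.2 `ν_E`; §1.3 `π_E` automorphic; §1.4 the `L`-factorisation for `Π(ϱ)`
# (`dim ϱ ≠ 1`), `πⁿ(ϱ_v)` ∕ `πˢ(ϱ_v)` (Langlands quotient, archimedean, unramified clauses), «`Π(ϱ) = ⊗Π(ϱ_v)`»,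
# «`π_v = πⁿ(ϱ_v)` for almost all `v`» — AS PRINTED, statement carpet over the shared datum of `Sec1Defs.lean`

S. Gelbart, J. Rogawski, *L-functions and Fourier–Jacobi coefficients for the unitary group `U(3)`*, Invent. Math. **105**
(1991) 445–472 [GelbartRogawski1991], §1 pp. 449–451 and Introduction p. 446.  Read on the GDZ page images
`img_p446/449/450/451.jpg` (PPN356556735_0105; cell copy `pub-hodgecm-cf-rogawski-g6/lit/GR91-invent105/`); «p. N Lk» =
printed page, approximate body line.  Carpet-typing squad TG (cell hodgecm-mathlib, seat TG-t05), file map `Sec<N>.lean`;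
namespaces `Literature.NumberTheory.GelbartRogawski1991.Sec1` (concrete notation, local datum) and — for the global
sentences — the namespace of the shared datum ★ `Sec1Defs.EndoscopicLData` (dot notation `D.lFactorisation`, the practice of
★ `Rogawski1990.ResidualSpectrumU3` extending ★ `GlobalPacketData`).

DISCIPLINE (that of ★ `GR91Spectrum` ∕ ★ `GR91LocalPacket` ∕ ★ `Rogawski1990.Ch13Sec8`): §1 has NO numbered statement; it
fixes notation and records a handful of sentences.  The concrete notation of §1.1–§1.2 is given REAL definitions over a
field with an involution (`Phi`, `heis`, `diagM`, `nuE`); every printed SENTENCE is a `Prop`-valued predicate over binders or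
over a posited datum — the squad's shared GLOBAL datum `D : EndoscopicLData X HeckeE HeckeF` of `Sec1Defs.lean` (over the ★
dictionary `X : GR91Spectrum`, with its places `D.Place` and ★ local dictionaries `D.loc v : GR91LocalPacket`) and ONE
local datum `LocalClassData Y` (over ★ `Y : GR91LocalPacket`) for the p. 450–451 local clauses — whose fields are the
CARRIERS and PRIMITIVES the sentences speak about.  **Nothing is asserted, nothing is proved: no theorem, no `sorry`, no
axiom, no instance, no notation.**  A consumer instantiates the data and takes `(h : D.lFactorisation)` etc. as explicit
hypotheses; the tacit identifications (`μ_v = (μ)_v`, `γ* = γν_E` in the group of Hecke characters, `ω(γ,ψ,χ)_v =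
ω(γ_v,ψ_v,χ_v)`, …) are the predicates of `D.Coherent`, not assumptions.

SCOPE (printed, §1.1 p. 449): «`E/F` = quadratic extension of number fields», «`U(n)` will denote a quasi-split unitary
group in `n` variables», `G` = the quasi-split `U(3)` of `Φ`.  The §1.4 local clauses are statements about `G_v` at ONE
place `v` and are typed over the LOCAL dictionary (as ★ `LocalAPackets` explains, they then apply to any inner form at the
places where it is isomorphic to `G_v`); the global sentences are about the quasi-split `G` only.

## What is typed (P = printed sentence as a predicate ∕ definition; C = cited by name, NOT restated)
* §1.1 p. 449 L17–33, p. 450 L1–10 — P: `Sec1.Phi` (the skew-Hermitian form `Φ = antidiag(1, ξ, −1)`, `Tr ξ = 0`),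
  `Sec1.heis` (`[w,t]`), `Sec1.diagM` (`d(α,β,ᾱ⁻¹)`), `Sec1.HeisMemG`, `Sec1.DiagMemG` (these matrices satisfy the membership
  equation of `G = {g : ᵗḡ Φ g = Φ}`), `Sec1.HeisMul` («`N` is the Heisenberg group attached to the `F`-vector space `E` with
  symplectic form `⟨x,y⟩ = Tr_{E/F}(ξxȳ)`»).  C: `G(R) = U(σ, Φ)(R)` itself is ★
  `Literature.NumberTheory.Automorphic.unitaryGroupOfForm σ (Phi ξ)` (membership `(g.map σ)ᵀ * Φ * g = Φ` = ★
  `mem_unitaryGroupOfForm_iff`); `E¹ ⊂ E*` is ★ `UnitaryGroup.normOneUnits σ`.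
* §1.2 p. 450 L13–14 — P: `Sec1.nuE` (`ν_E(α) = ν(α/ᾱ)`, «the base change of `ν` to `GL_{1/E}`») DEFINED through ★
  `UnitaryGroup.quotConj σ hσ : Rˣ →* E¹` ([Rogawski1990 §12.1] «`χ̃(a) = χ(a/ā)`», already in the tree); at dictionary
  level `ν_E` is the ★ action `ν • γ = γ ν_E` of `GR91Spectrum` ∕ `GR91LocalPacket` and the datum's `bc1`; their agreement is
  the predicate `EndoscopicLData.ofOmega_smul`.
* §1.3 p. 450 L15–19 — C: the DEFINITION `L(s, π ⊗ ξ) := L(s, π_E ⊗ ξ)` = ★ `Sec1Defs.EndoscopicLData.Lstd` (shared datum);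
  P: `bcG_automorphic` («The base change `π_E` of `π` to `GL_{3/E}` is an automorphic representation of `GL_{3/E}` ([R])»;
  [R] = [Rogawski1990] §13.3 p. 202, the global base change `ψ_G` = ★
  `Literature.NumberTheory.Rogawski1990.Ch13Sec3.GlobalBaseChange.psiG`, cited not restated).
* §1.4 p. 450 L20–35 — P: `resF_ofOmega` («`μ` … whose restriction to `C_F` is the character `ω_{E/F}`»), `res1_ofOmega`,
  `bcU2_automorphic` («The base change lift `ϱ_{2E}` is an automorphic representation of `GL_{2/E}`»), **`lFactorisation`**
  («For all `π ∈ Π(ϱ)`, we have `L(s, π⊗ξ) = L(s, ϱ_{2E} ⊗ μξ)L(s, ϱ_{1E} ⊗ ξ)`», `dim ϱ ≠ 1`), `packetL_tensor` («an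
  `L`-packet `Π` on `G` is a "tensor product" `⊗Π_v`»).  C: the `dim ϱ = 1` companion (first display of §5.1, p. 465) =
  the §5 carpet's `Literature.NumberTheory.GelbartRogawski1991.Sec5.eq511L` (squad ruling: printed-locus rule), not restated;
  `μ`, `ξ_H`, `H = U(2) × U(1)`, the A-packets `Π(ϱ)` (`dim ϱ = 1`) = ★ `GR91Spectrum.{mu, packetA}`; «unique elliptic
  endoscopic group … [R, pp. 51–52]» = [Rogawski1990] §4.8.
* §1.4 p. 450 L36 – p. 451 L6 (local) — P over `Sec1.LocalClassData Y`: `pin_isLanglandsQuotient` («`πⁿ(ϱ_v)` [is] the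
  Langlands quotient of the principal series representation induced from the character `ν` of `B_v` defined by
  `ν(d(α, β, ᾱ⁻¹)) = μ_v(α)η_v(α/ᾱ)η′_v((α/ᾱ)β)‖α‖_v^{1/2}`»), `pis_archimedean` («if `v` is archimedean then `πˢ(ϱ_v)` is
  either in the discrete series (holomorphic or anti-holomorphic) or limit of discrete series»), `pin_unramified` («If `v` is
  finite and the characters `μ_v, η_v`, and `η′_v` are unramified, then `πⁿ(ϱ_v)` is unramified»).  C: «If `v` is split, then
  `Π(ϱ_v) = {πⁿ(ϱ_v)}`. If `v` remains prime … `Π(ϱ_v) = {πⁿ(ϱ_v), πˢ(ϱ_v)}`» = ★ `GR91LocalPacket.packetShape`; «If `v` is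
  finite, then `πˢ(ϱ_v)` is supercuspidal» = ★ `GR91LocalPacket.pis_supercuspidal`; the CONCRETE `ν` and `i_G(ν)` for a CM
  field = ★ `UnitaryGroup.xiTorusChar σ J hJ hσ 0 μ η η′` (token for token: `η₁ := η`, `η₂ := η′`) and ★
  `UnitaryGroup.principalSeries` (file `UnitaryGroupBorelInduction`).
* Introduction p. 446 L6–23 + §1.4 p. 451 L6 (global ↔ local) — P: `mu_loc`, `flags_loc`, `smul_res1_loc`, `weil_loc`
  (dictionary coherence), `packetA_tensor` («Of course, `Π(ϱ)` is a "tensor product" `⊗Π(ϱ_v)`»), `badSet` («Let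
  `X = {v : π_v = πˢ(ϱ)}`»), **`pin_almostAll`** («hence if `π = ⊗π_v ∈ Π(ϱ)`, then `π_v = πⁿ(ϱ_v)` for almost all `v`»),
  `weil_pin_almostAll` («if `π ∈ Ω`, then for almost all `v`, there is a character `ϱ_v` of `H_v` such that `π_v = πⁿ(ϱ_v)`»).
  C: «By [R₂, Theorem 1.1], an element `π` of `Π(ϱ)` is discrete … if and only if `(−1)^{|X|} = ε(½, φ)`» = ★
  `Literature.NumberTheory.Rogawski1992.Sec1.MultiplicityFormulaQuasiSplit` (not restated); «[R, Theorem 13.3.6(c)]» = ★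
  `Rogawski1990` §13.3 (squad TR index `Ch13Sec3`); the rest of the Introduction (Weil representations, the two main results,
  the `H¹` sentence) = ★ `GR91Spectrum.{weil_discrete, weil_eq_iff, discreteMembers_eq, intro_h1_weil}`.
NOT typed: «`R = SN` … `N \ R` is isomorphic to `(E¹)²`» (p. 450 L9–10, recorded in the docstring of `HeisMul`); the integral
`(∗)` of p. 446 and everything about `L_S`, `E(g, ξ, s)` (§4 carpet `Sec4.lean`); anything of §§2–6.

READING RECORDED (p. 450 first display; squad [sic] policy): on the GDZ scan the `(2,3)` entry of `[w,t]` reads «`w`»;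
membership `[w,t] ∈ G` for `Φ = antidiag(1, ξ, −1)` and the Heisenberg law «`⟨x,y⟩ = Tr_{E/F}(ξxȳ)`» printed four lines
below both force «`w̄`» — `heis` carries `σ w` there and its docstring says «printed `w` [sic]»; the cite desk is asked to
confirm the bar on the original.

## References
* [GelbartRogawski1991] S. Gelbart, J. Rogawski, Invent. Math. 105 (1991) 445–472: §1.1–§1.4 pp. 449–451; Introduction
  p. 446; §3.2 Remark (1) pp. 457–458; proof of Prop. 3.4.1 p. 459; Thm. 5.1.1 p. 465 L21; Lem. 5.1.2 p. 466.
* [Rogawski1990] J. Rogawski, *Automorphic representations of unitary groups in three variables*, Ann. of Math. Stud. 123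
  (1990) (= [R]): §4.8 pp. 51–52 (`ξ_H`), §12.1 p. 172 (`χ̃`), §12.2 pp. 173–174 (`χ_ξ`, `πⁿ`), §13.3 p. 202 (`ψ_G`,
  Thm. 13.3.6).
* [Rogawski1992] J. Rogawski, *The multiplicity formula for A-packets*, CRM Montréal (1992) 395–419 (= [R₂]), Thm. 1.1 —
  cited through p. 446; tree statement ★ `Rogawski1992.Sec1.MultiplicityFormulaQuasiSplit`.
-/

noncomputable section

namespace Literature.NumberTheory.GelbartRogawski1991

universe u

namespace Sec1

open Literature.NumberTheory.Automorphic.UnitaryGroup (normOneUnits quotConj)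

/-! ## §1.1–§1.2  The concrete notation (pp. 449–450): `Φ`, `[w,t]`, `d(α,β,ᾱ⁻¹)`, `ν_E` -/

section Concrete

variable {K : Type*} [Field K] (σ : K →+* K)

/-- **The skew-Hermitian form `Φ` of §1.1**: «For `n = 3`, we fix `Φ = ( · · 1 ∕ · ξ · ∕ −1 · · )` where `ξ ∈ E*`,
`Tr_{E/F}(ξ) = 0` and denote by `G` the (quasi-split) unitary group of the skew-Hermitian form `Φ`.»  Here over any
field `K` (intended `K = E` with its conjugation `σ`, `F = K^σ`, and `σ ξ = −ξ`, `ξ ≠ 0`); `G(F) = U(σ, Φ)(E)` is ★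
`unitaryGroupOfForm σ (Phi ξ)` = `{g ∈ GL₃(E) : ᵗ(σg) Φ g = Φ}`.  [cite: GelbartRogawski1991, §1.1 p. 449 L26–32] -/
def Phi (ξ : K) : Matrix (Fin 3) (Fin 3) K :=
  !![0, 0, 1; 0, ξ, 0; -1, 0, 0]

/-- **The element `[w, t]` of `N`** (p. 450 first display): «`[w,t] = ( 1  wξ  ξww̄/2 + t ∕ · 1  w ∕ · · 1 )` where `w ∈ E`
and `t ∈ F`» — AS READ on the GDZ scan, which shows «`w`» in position `(2,3)`.  READING RECORDED: `ᵗ(σg)Φg = Φ` and the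
Heisenberg law of the same page force that entry to be `w̄ = σ w`, which is what is typed (module docstring); the cite desk
is asked to confirm the bar on the original.  `/ 2` is the field division (intended characteristic `0`).
[cite: GelbartRogawski1991, §1.1 p. 450 L1–3] -/
def heis (ξ w t : K) : Matrix (Fin 3) (Fin 3) K :=
  !![1, w * ξ, ξ * w * σ w / 2 + t; 0, 1, σ w; 0, 0, 1]

/-- **The element `diag(α, β, ᾱ⁻¹)` of `M`** (p. 450 second display): «`diag(α, β, ᾱ⁻¹) = ( α · · ∕ · β · ∕ · · ᾱ⁻¹ )`
where `α ∈ E*`, `β ∈ E¹`» (written `d(α, β, ᾱ⁻¹)` on p. 450 L38). [cite: GelbartRogawski1991, §1.1 p. 450 L4–6] -/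
def diagM (α β : K) : Matrix (Fin 3) (Fin 3) K :=
  !![α, 0, 0; 0, β, 0; 0, 0, (σ α)⁻¹]

/-- **P** «`N` = unipotent radical of `B`», `[w,t] ∈ N ⊂ G` (p. 449 L35, p. 450 L1–3): for `σ` an involution with
`σ ξ = −ξ` («`Tr_{E/F}(ξ) = 0`»), every `w ∈ E` and every `σ`-fixed `t` («`t ∈ F`»), the matrix `[w,t]` satisfies the
membership equation `ᵗ(σ[w,t]) Φ [w,t] = Φ` of `G = U(Φ)` (★ `mem_unitaryGroupOfForm_iff`); characteristic `≠ 2` (the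
entry `ξww̄/2`; number fields).  An elementary matrix identity («K-provable» by `simp`∕`ring`; carpets carry no
proofs), recorded as the printed sentence. [cite: GelbartRogawski1991, §1.1 p. 449 L33–35, p. 450 L1–3] -/
def HeisMemG (σ : K →+* K) (ξ : K) : Prop :=
  (∀ x : K, σ (σ x) = x) → σ ξ = -ξ → (2 : K) ≠ 0 →
    ∀ w t : K, σ t = t → Matrix.transpose ((heis σ ξ w t).map σ) * Phi ξ * heis σ ξ w t = Phi ξ

/-- **P** «`M` = diagonal subgroup of `G`», `diag(α, β, ᾱ⁻¹) ∈ M` for «`α ∈ E*`, `β ∈ E¹`» (p. 449 L36, p. 450 L4–6):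
for `σ` an involution, `α ≠ 0` and `σ(β) β = 1`, `ᵗ(σ d) Φ d = Φ` for `d = diag(α, β, ᾱ⁻¹)`.  Elementary («K-provable»);
recorded, not proved. [cite: GelbartRogawski1991, §1.1 p. 449 L36, p. 450 L4–6] -/
def DiagMemG (σ : K →+* K) (ξ : K) : Prop :=
  (∀ x : K, σ (σ x) = x) →
    ∀ α β : K, α ≠ 0 → σ β * β = 1 → Matrix.transpose ((diagM σ α β).map σ) * Phi ξ * diagM σ α β = Phi ξ

/-- **P** «The group `N` is the Heisenberg group attached to the `F`-vector space `E` with symplectic form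
`⟨x, y⟩ = Tr_{E/F}(ξ x ȳ)`. Its center is `U = {[0,t] : t ∈ F}`.» — as the multiplication law
`[w,t][w′,t′] = [w + w′, t + t′ + ½ Tr_{E/F}(ξ w w̄′)]` (`Tr_{E/F}(x) = x + σx`), valid for `σ` an involution with
`σ ξ = −ξ` in characteristic `≠ 2`; in particular `[0,t]` is central and `[w,0][w′,0][w,0]⁻¹[w′,0]⁻¹ = [0, ⟨w,w′⟩]`.  Same page: «We have
`R = SN`, where `S = {diag(α, β, α), α, β ∈ E¹}`. Furthermore `N \ R` is isomorphic to `(E¹)²`» (not typed).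
Elementary («K-provable»); recorded, not proved. [cite: GelbartRogawski1991, §1.1 p. 450 L7–10] -/
def HeisMul (σ : K →+* K) (ξ : K) : Prop :=
  (∀ x : K, σ (σ x) = x) → σ ξ = -ξ → (2 : K) ≠ 0 →
    ∀ w t w' t' : K,
      heis σ ξ w t * heis σ ξ w' t' = heis σ ξ (w + w') (t + t' + (ξ * w * σ w' + σ (ξ * w * σ w')) / 2)

/-- **§1.2 `ν_E` — «If `ν` is a character of `E¹` (locally or globally), we define a character `ν_E` of `E*` by
`ν_E(α) = ν(α/ᾱ)`. It is the base change of `ν` to `GL_{1/E}`.»**  DEFINED for any commutative ring `R` with an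
involution `σ` (intended: `E`, `E_v = E ⊗_F F_v`, `𝔸_E`) and any character `ν : E¹ →* M` of the norm-one units
★ `normOneUnits σ = {β ∈ Rˣ : σ(β) β = 1}`, as `ν ∘ (α ↦ α · σ(α)⁻¹)` through the tree's ★ `quotConj σ hσ : Rˣ →* E¹`
([Rogawski1990 §12.1 p. 172] «`χ̃(a) = χ(a/ā)`», the same map).  At dictionary level this is the ★ action
`ν • γ = γ ν_E` of `GR91Spectrum.Char1` on `OmegaHecke` and the homomorphism `EndoscopicLData.bc1` below.
[cite: GelbartRogawski1991, §1.2 p. 450 L13–14] -/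
def nuE {R : Type*} [CommRing R] (σ : R →+* R) (hσ : ∀ x : R, σ (σ x) = x) {M : Type*} [CommMonoid M]
    (ν : ↥(normOneUnits σ) →* M) : Rˣ →* M :=
  ν.comp (quotConj σ hσ)

end Concrete

/-! ## §1.4, local clauses  (p. 450 L36 – p. 451 L6), over the ★ local dictionary `Y : GR91LocalPacket` -/

/-- **`LocalClassData Y` — the posited LOCAL datum at the place `v`** for the p. 450–451 clauses not already in ★
`GR91LocalPacket` (`Y`: `G_v`, `μ_v = Y.mu`, `η_v, η′_v ∈ Y.Char1`, `πⁿ(ϱ_v) = Y.pin η η′`, `πˢ(ϱ_v) = Y.pis η η′`).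
Fields (intended meaning; NOTHING asserted):
* `IsUnramifiedRep π` — «`π` is unramified» (has a `K_v`-fixed vector), `IsUnramified1 η` — the character `η_v` of `E_v¹` is
  unramified, `IsUnramifiedΩ γ` — the character `γ_v` of `E_v*` (e.g. `μ_v`) is unramified [p. 451 L5–6];
* `IsDiscreteSeries`, `IsHolomorphic`, `IsAntiholomorphic`, `IsLimitOfDiscreteSeries` — the archimedean classes of p. 451
  L3–4 (at an archimedean non-split `v`, `G_v ≅ U(2,1)`);
* `CharB` — characters of `B_v` trivial on `N_v` (= characters of the diagonal torus `M_v = {d(α, β, ᾱ⁻¹)}`);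
* `nuOf η η′ = ν` — «the character `ν` of `B_v` defined by `ν(d(α, β, ᾱ⁻¹)) = μ_v(α) η_v(α/ᾱ) η′_v((α/ᾱ)β) ‖α‖_v^{1/2}`»
  (concretely, for a CM field, ★ `UnitaryGroup.xiTorusChar σ J hJ hσ 0 μ_v η_v η′_v`: its value at `t = d(α,β,ᾱ⁻¹)` is
  `η(α/ᾱ)·μ(α)·‖α‖^{1/2}·η′(det t)` and `det t = (α/ᾱ)β`);
* `langlandsQuotient ν` — «the Langlands quotient of the principal series representation induced from the character `ν`
  of `B_v`» (`i_G(ν)` = ★ `UnitaryGroup.principalSeries`; junk when `ν` is not in Langlands position).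
[cite: GelbartRogawski1991, §1.4 p. 450 L36–40, p. 451 L1–6] -/
structure LocalClassData (Y : GR91LocalPacket.{u}) : Type (u + 1) where
  /-- «`π_v` is unramified» [p. 451 L5–6] -/
  IsUnramifiedRep : Y.LocRep → Prop
  /-- the character `η_v` of `E_v¹` is unramified [p. 451 L5] -/
  IsUnramified1 : Y.Char1 → Prop
  /-- the character `γ_v` of `E_v*` with `γ_v|F_v* = ω` (e.g. `μ_v`) is unramified [p. 451 L5] -/
  IsUnramifiedΩ : Y.OmegaHecke → Prop
  /-- «in the discrete series» (archimedean `v`) [p. 451 L3–4] -/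
  IsDiscreteSeries : Y.LocRep → Prop
  /-- «holomorphic» discrete series [p. 451 L4] -/
  IsHolomorphic : Y.LocRep → Prop
  /-- «anti-holomorphic» discrete series [p. 451 L4] -/
  IsAntiholomorphic : Y.LocRep → Prop
  /-- «limit of discrete series» [p. 451 L4] -/
  IsLimitOfDiscreteSeries : Y.LocRep → Prop
  /-- characters `ν` of `B_v` (trivial on `N_v`) [p. 450 L38–40] -/
  CharB : Type u
  /-- `(η_v, η′_v) ↦ ν`, `ν(d(α,β,ᾱ⁻¹)) = μ_v(α)η_v(α/ᾱ)η′_v((α/ᾱ)β)‖α‖_v^{1/2}` [p. 450 L38–40] -/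
  nuOf : Y.Char1 → Y.Char1 → CharB
  /-- `ν ↦` the Langlands quotient of `Ind_{B_v}^{G_v} ν` [p. 450 L37–38] -/
  langlandsQuotient : CharB → Y.LocRep

namespace LocalClassData

variable {Y : GR91LocalPacket.{u}} (C : LocalClassData Y)

/-- **P** «For all `v`, let `πⁿ(ϱ_v)` be the Langlands quotient of the principal series representation induced from the
character `ν` of `B_v` defined by `ν(d(α, β, ᾱ⁻¹)) = μ_v(α) η_v(α/ᾱ) η′_v((α/ᾱ)β) ‖α‖_v^{1/2}`.» — the DEFINING relation of
★ `Y.pin` in terms of the datum. [cite: GelbartRogawski1991, §1.4 p. 450 L36–40] -/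
def pin_isLanglandsQuotient (C : LocalClassData Y) : Prop :=
  ∀ η η' : Y.Char1, Y.pin η η' = C.langlandsQuotient (C.nuOf η η')

/-- **P** «… and if `v` is archimedean then `πˢ(ϱ_v)` is either in the discrete series (holomorphic or anti-holomorphic) or
limit of discrete series.»  (`πˢ(ϱ_v)` exists when `v` «remains prime», ★ `packetShape`; «archimedean» = not finite.)
The finite clause «`πˢ(ϱ_v)` is supercuspidal» is ★ `GR91LocalPacket.pis_supercuspidal`. [cite: GelbartRogawski1991, §1.4 p. 451 L3–4] -/
def pis_archimedean (C : LocalClassData Y) : Prop :=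
  ¬ Y.IsFinite → ¬ Y.IsSplit → ∀ η η' : Y.Char1,
    (C.IsDiscreteSeries (Y.pis η η') ∧ (C.IsHolomorphic (Y.pis η η') ∨ C.IsAntiholomorphic (Y.pis η η'))) ∨
      C.IsLimitOfDiscreteSeries (Y.pis η η')

/-- **P** «If `v` is finite and the characters `μ_v, η_v`, and `η′_v` are unramified, then `πⁿ(ϱ_v)` is unramified».
[cite: GelbartRogawski1991, §1.4 p. 451 L5–6] -/
def pin_unramified (C : LocalClassData Y) : Prop :=
  Y.IsFinite → ∀ η η' : Y.Char1,
    C.IsUnramifiedΩ Y.mu → C.IsUnramified1 η → C.IsUnramified1 η' → C.IsUnramifiedRep (Y.pin η η')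

/-- The three local clauses as one conjunction. [cite: GelbartRogawski1991, §1.4 p. 450 L36 – p. 451 L6] -/
def Laws (C : LocalClassData Y) : Prop :=
  C.pin_isLanglandsQuotient ∧ C.pis_archimedean ∧ C.pin_unramified

end LocalClassData

end Sec1

/-! ## §1.3–§1.4 and the Introduction: the printed GLOBAL sentences, over the shared datum `D : EndoscopicLData X HeckeE HeckeF`
(`Sec1Defs.lean`).  Declared in the datum's namespace so that consumers write `D.lFactorisation`, `D.pin_almostAll`, …
(the practice of ★ `Rogawski1990.ResidualSpectrumU3` extending ★ `GlobalPacketData`). -/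

namespace Sec1Defs.EndoscopicLData

variable {X : GR91Spectrum.{u}} {HeckeE HeckeF : Type u} [CommGroup HeckeE] [CommGroup HeckeF]
  (D : EndoscopicLData X HeckeE HeckeF)

/-! ### Dictionary coherence (the identifications the print makes tacitly; predicates, NOT asserted) -/

/-- **§1.2 with §3.2 Remark (1)** («If `γ*` is any other Hecke character with this property, then `γ* = γν_E`», typed in ★
`GR91Spectrum` as the action `ν • γ`): read in the group of Hecke characters of `E`, `(ν • γ) = ν_E · γ`.
[cite: GelbartRogawski1991, §1.2 p. 450 L13–14; §3.2 Remark (1) pp. 457–458] -/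
def ofOmega_smul (D : EndoscopicLData X HeckeE HeckeF) : Prop :=
  ∀ (ν : X.Char1) (γ : X.OmegaHecke), D.ofOmega (ν • γ) = D.bc1 ν * D.ofOmega γ

/-- **§1.4 «Fix a character `μ` of the idele class group `C_E` whose restriction to `C_F` is the character `ω_{E/F}`»** (and
p. 447 L1–2 «Hecke character `γ` of the idele group `I_E` whose restriction to `I_F` is `ω_{E/F}`», the meaning of ★
`X.OmegaHecke`): every `γ ∈ X.OmegaHecke`, in particular `μ`, restricts to `ω_{E/F}`.
[cite: GelbartRogawski1991, §1.4 p. 450 L20–21; Introduction p. 447 L1–2] -/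
def resF_ofOmega (D : EndoscopicLData X HeckeE HeckeF) : Prop :=
  ∀ γ : X.OmegaHecke, D.resF (D.ofOmega γ) = D.omegaEF

/-- **«`γ¹` is the restriction of `γ` to the norm one elements»** (p. 465 L21): the ★ dictionary's `X.res1 γ` is the datum's
`res1` of `γ` read as a Hecke character. [cite: GelbartRogawski1991, Thm. 5.1.1 p. 465 L21] -/
def res1_ofOmega (D : EndoscopicLData X HeckeE HeckeF) : Prop :=
  ∀ γ : X.OmegaHecke, X.res1 γ = D.res1 (D.ofOmega γ)

/-- **`μ_v` is the local component of `μ`** (§1.4 «`μ_v`», p. 450 L40): the ★ local dictionary's `mu` at `v` is `locOmega μ v`.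
[cite: GelbartRogawski1991, §1.4 p. 450 L20, L40] -/
def mu_loc (D : EndoscopicLData X HeckeE HeckeF) : Prop :=
  ∀ v : D.Place, (D.loc v).mu = D.locOmega X.mu v

/-- **«`v` is split (resp., non-split) if `v` splits (resp., remains prime) in `E`»** read on the local dictionary at `v`:
`IsSplitPlace v ↔ (loc v).IsSplit`, and likewise «`v` is finite». [cite: GelbartRogawski1991, §1.1 p. 449 L21–23; §1.4 p. 451 L1–3] -/
def flags_loc (D : EndoscopicLData X HeckeE HeckeF) : Prop :=
  ∀ v : D.Place, (D.IsSplitPlace v ↔ (D.loc v).IsSplit) ∧ (D.IsFinitePlace v ↔ (D.loc v).IsFinite)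

/-- **§1.2 «locally or globally»**: the local component of `γν_E` is `γ_v ν_{v,E}` and of `γ¹` is `(γ_v)¹` — the ★ actions and
restrictions of `GR91Spectrum` and `GR91LocalPacket` commute with `locOmega`∕`locChar` (so `(gammaOf η η′)_v =
gammaOf η_v η′_v` and `(chiOf η η′)_v = chiOf η_v η′_v`, the passage used in the proof of Lemma 5.1.2, p. 466 L15–17).
[cite: GelbartRogawski1991, §1.2 p. 450 L13–14; Lem. 5.1.2 p. 466 L15–17] -/
def smul_res1_loc (D : EndoscopicLData X HeckeE HeckeF) : Prop :=
  ∀ v : D.Place,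
    (∀ (ν : X.Char1) (γ : X.OmegaHecke), D.locOmega (ν • γ) v = D.locChar ν v • D.locOmega γ v) ∧
      (∀ γ : X.OmegaHecke, (D.loc v).res1 (D.locOmega γ v) = D.locChar (X.res1 γ) v) ∧
      (∀ ν ν' : X.Char1, D.locChar (ν * ν') v = D.locChar ν v * D.locChar ν' v)

/-- **The local component of the Weil representation `ω(γ, ψ, χ)` at `v` is the local Weil representation
`ω(γ_v, ψ_v, χ_v)`** («`Θ(γ, ψ, χ)` … each `G_v`-module `𝒮(χ_v, ψ_v)` is irreducible», proof of Prop. 3.4.1 p. 459 L28–30;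
«We know that `ω(γ, ψ, χ) ∈ Π(ϱ)` and hence locally `ω(γ_v, ψ_v, χ_v) ∈ Π(ϱ_v)`», p. 466 L16–17) — the identification of ★
`X.weil` with ★ `(loc v).weil` along `comp`. [cite: GelbartRogawski1991, proof of Prop. 3.4.1 p. 459 L28–30; Lem. 5.1.2 p. 466 L16–17] -/
def weil_loc (D : EndoscopicLData X HeckeE HeckeF) : Prop :=
  ∀ (γ : X.OmegaHecke) (ψ : X.AddChar) (χ : X.Char1) (v : D.Place),
    D.comp (X.weil γ ψ χ) v = (D.loc v).weil (D.locOmega γ v) (D.locAdd ψ v) (D.locChar χ v)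

/-- The coherence predicates as one conjunction. [cite: GelbartRogawski1991, §1.2–§1.4 pp. 450–451] -/
def Coherent (D : EndoscopicLData X HeckeE HeckeF) : Prop :=
  D.ofOmega_smul ∧ D.resF_ofOmega ∧ D.res1_ofOmega ∧ D.mu_loc ∧ D.flags_loc ∧ D.smul_res1_loc ∧ D.weil_loc

/-! ### §1.3–§1.4: base change and the `L`-factorisation (p. 450) -/

/-- **P** «Let `π` be a discrete representation of `G`. The base change `π_E` of `π` to `GL_{3/E}` is an automorphic
representation of `GL_{3/E}` ([R]).»  ([R] = [Rogawski1990] §13.3 p. 202, the base change `ψ_G(Π) = ⊗_v ψ_G(Π_v)`; tree: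
★ `Literature.NumberTheory.Rogawski1990.Ch13Sec3.GlobalBaseChange.psiG`, not restated.) [cite: GelbartRogawski1991, §1.3 p. 450 L15–17] -/
def bcG_automorphic (D : EndoscopicLData X HeckeE HeckeF) : Prop :=
  ∀ π : X.Rep, X.IsDiscrete π → D.IsAutomorphicGL3E (D.bcG π)

/-- **P** «The base change lift `ϱ_{2E}` is an automorphic representation of `GL_{2/E}`.» (In the paragraph on discrete
`L`-packets `ϱ = ϱ₂ × ϱ₁` on `H` with `dim(ϱ) ≠ 1`; typed with exactly these hypotheses — `ϱ` discrete ⇔ `ϱ₂` discrete, `ϱ₁`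
being an automorphic character.) [cite: GelbartRogawski1991, §1.4 p. 450 L34–35] -/
def bcU2_automorphic (D : EndoscopicLData X HeckeE HeckeF) : Prop :=
  ∀ ϱ₂ : D.PacketU2, D.IsDiscreteU2 ϱ₂ → ¬ D.IsOneDimU2 ϱ₂ → D.IsAutomorphicGL2E (D.bcU2 ϱ₂)

/-- **P — the `L`-function of an endoscopic `L`-packet (§1.4).** «If `dim(ϱ) ≠ 1`, we denote by `Π(ϱ)` the `L`-packet on
`G` corresponding to `ϱ` with respect to `ξ_H`. For all `π ∈ Π(ϱ)`, we have `L(s, π⊗ξ) = L(s, ϱ_{2E} ⊗ μξ) L(s, ϱ_{1E} ⊗ ξ)`,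
where `ϱ_{jE}` denotes the base change lift of `ϱ_j` to `GL_{j/E}`.»  Here `ϱ = ϱ₂ × ϱ₁` is a discrete `L`-packet on
`H = U(2) × U(1)` (`ϱ₁ ∈ X.Char1`; `ϱ` discrete ⇔ `ϱ₂` discrete), `μξ = ofOmega μ · ξ`, `ϱ_{1E} ⊗ ξ = (ϱ₁)_E · ξ =
bc1 ϱ₁ · ξ`, and `L(s, χ)` of a Hecke character `χ` of `E` is `LHecke χ`.  An identity of `L`-FUNCTIONS (Euler products):
typed on a right half-plane `Re s > C` (some `C`, depending on `ξ`), where all three are genuine values — literally faithful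
and safe for the junk values of the `ℂ`-valued sockets at poles.  The `dim ϱ = 1` companion (first display of §5.1, p. 465: «`L(s + ½, π ⊗ ξ) =
L_E(s + 1, μη_Eη′_Eξ) L_E(s + ½, η′_Eξ) L_E(s, μη_Eη′_Eξ)`») is the §5 carpet's
`Literature.NumberTheory.GelbartRogawski1991.Sec5.eq511L` (same datum), not restated here. [cite: GelbartRogawski1991, §1.4 p. 450 L29–34] -/
def lFactorisation (D : EndoscopicLData X HeckeE HeckeF) : Prop :=
  ∀ (ϱ₂ : D.PacketU2) (ϱ₁ : X.Char1), D.IsDiscreteU2 ϱ₂ → ¬ D.IsOneDimU2 ϱ₂ →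
    ∀ π ∈ D.packetL ϱ₂ ϱ₁, ∀ ξ : HeckeE, ∃ C : ℝ, ∀ s : ℂ, C < s.re →
      D.Lstd π ξ s = D.LGL2E (D.bcU2 ϱ₂) (D.ofOmega X.mu * ξ) s * D.LHecke (D.bc1 ϱ₁ * ξ) s

/-! ### «`Π(ϱ)` is a "tensor product" `⊗Π(ϱ_v)`» — Introduction p. 446 and §1.4 p. 451 L6 -/

/-- **P** «As usual, an `L`-packet `Π` on `G` is a "tensor product" `⊗Π_v` of local `L`-packets `Π_v`» read member-wise for
the endoscopic packets `Π(ϱ)`, `dim ϱ ≠ 1`: the local component at `v` of a member lies in the local packet `Π(ϱ_v)`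
(`locPacketL`). [cite: GelbartRogawski1991, §1.4 p. 450 L26–31] -/
def packetL_tensor (D : EndoscopicLData X HeckeE HeckeF) : Prop :=
  ∀ (ϱ₂ : D.PacketU2) (ϱ₁ : X.Char1) (π : X.Rep), π ∈ D.packetL ϱ₂ ϱ₁ →
    ∀ v : D.Place, D.comp π v ∈ D.locPacketL v ϱ₂ ϱ₁

/-- **P** «Of course, `Π(ϱ)` is a "tensor product" `⊗Π(ϱ_v)`.» (the A-packets, `dim ϱ = 1`) read member-wise: the local
component at `v` of a member of `Π(ϱ)`, `ϱ = (η, η′)`, lies in the local A-packet `Π(ϱ_v)` of `ϱ_v = (η_v, η′_v)` (★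
`(loc v).packetA`).  (Which `⊗π_v` with `π_v ∈ Π(ϱ_v)` are DISCRETE is the multiplicity rule «By [R₂, Theorem 1.1] …
`(−1)^{|X|} = ε(½, φ)`» = ★ `Literature.NumberTheory.Rogawski1992.Sec1.MultiplicityFormulaQuasiSplit`, not restated.)
[cite: GelbartRogawski1991, Introduction p. 446 L6] -/
def packetA_tensor (D : EndoscopicLData X HeckeE HeckeF) : Prop :=
  ∀ (η η' : X.Char1) (π : X.Rep), π ∈ X.packetA η η' →
    ∀ v : D.Place, D.comp π v ∈ (D.loc v).packetA (D.locChar η v) (D.locChar η' v)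

/-- **«Let `X = {v : π_v = πˢ(ϱ)}`»** (Introduction p. 446 L8–9), for `π` and `ϱ = (η, η′)`: the set of places where the local
component is the additional member `πˢ(ϱ_v)` (★ `(loc v).pis`).  (Its parity enters the multiplicity rule ★
`Rogawski1992.Sec1.MultiplicityFormulaQuasiSplit`.) [cite: GelbartRogawski1991, Introduction p. 446 L8–9] -/
def badSet (η η' : X.Char1) (π : X.Rep) : Set D.Place :=
  {v : D.Place | D.comp π v = (D.loc v).pis (D.locChar η v) (D.locChar η' v)}

/-- **P** «If `v` is finite and the characters `μ_v, η_v`, and `η′_v` are unramified, then `πⁿ(ϱ_v)` is unramified, and hence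
if `π = ⊗π_v ∈ Π(ϱ)`, then `π_v = πⁿ(ϱ_v)` for almost all `v`.» — the global half: for a member `π` of the A-packet `Π(ϱ)`,
`ϱ = (η, η′)`, the set of places with `π_v ≠ πⁿ(ϱ_v)` is finite (so, with ★ `packetShape` and `packetA_tensor`, `badSet` is
finite; «They are almost everywhere non-tempered», p. 446 L12).  The local half is `Sec1.LocalClassData.pin_unramified`.
[cite: GelbartRogawski1991, §1.4 p. 451 L5–6; Introduction p. 446 L11–12] -/
def pin_almostAll (D : EndoscopicLData X HeckeE HeckeF) : Prop :=
  ∀ (η η' : X.Char1) (π : X.Rep), π ∈ X.packetA η η' →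
    {v : D.Place | D.comp π v ≠ (D.loc v).pin (D.locChar η v) (D.locChar η' v)}.Finite

/-- **P-INTRO** «It is not hard to check that if `π ∈ Ω`, then for almost all `v`, there is a character `ϱ_v` of `H_v` such that
`π_v = πⁿ(ϱ_v)`.» (`Ω` = the Weil representations `ω(γ, ψ, χ)`, ★ `X.weil`; a local one-dimensional `ϱ_v` = a pair
`(η_v, η′_v)` of characters of `E_v¹`.)  Followed in print by «We may then apply [R, Theorem 13.3.6(c)] …» = ★
`Rogawski1990` §13.3 (squad TR's `Ch13Sec3` index), not restated. [cite: GelbartRogawski1991, Introduction p. 446 L21–23] -/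
def weil_pin_almostAll (D : EndoscopicLData X HeckeE HeckeF) : Prop :=
  ∀ (γ : X.OmegaHecke) (ψ : X.AddChar) (χ : X.Char1),
    {v : D.Place | ∀ ηv ηv' : (D.loc v).Char1, D.comp (X.weil γ ψ χ) v ≠ (D.loc v).pin ηv ηv'}.Finite

/-- **The printed global sentences of §1.3–§1.4 and of the Introduction's packet paragraph as one conjunction**
(`bcG_automorphic`, `bcU2_automorphic`, `lFactorisation`, `packetL_tensor`, `packetA_tensor`, `pin_almostAll`,
`weil_pin_almostAll`). [cite: GelbartRogawski1991, §1.3–§1.4 pp. 450–451; Introduction p. 446 L6–23] -/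
def Sec1Statements (D : EndoscopicLData X HeckeE HeckeF) : Prop :=
  D.bcG_automorphic ∧ D.bcU2_automorphic ∧ D.lFactorisation ∧ D.packetL_tensor ∧ D.packetA_tensor ∧
    D.pin_almostAll ∧ D.weil_pin_almostAll

end Sec1Defs.EndoscopicLData

end Literature.NumberTheory.GelbartRogawski1991

end
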